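import Summits.NavierStokesRegularity.NavierStokesRegularity.Theses.HodographBetchov

/-!
# `ClassBudgetsRegularise` is false without the decay of the datum

Negative-side support for the crux `ClassBudgetsRegularise` (stmt-NavierStokesRegularity-16863, route
`HodographBetchov`, the Betchov–Miller bridge in Clay (A)-form), refuter crux-attack at vetting
(2026-08-17). Theorems only (no definitions).

The bridge says: for a Clay datum `u₀` (smooth, divergence free, rapidly decaying), if along every
classical solution on every `[0, T)` that is Leray–Hopf from `u 0 = u₀` some speed level carries both
class budgets, then `u₀` launches a global smooth solution of bounded energy. The budget hypothesis
only bites through the EXISTENCE of classical Leray–Hopf solutions from `u₀` (local theory), and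
`IsLerayHopfOn T ν 0 (u 0) u` forces the slice `u 0 = u₀` into `L²(ℝ³)` (`memLp` at `t = 0`). Hence,
with the decay hypothesis `HasRapidSpatialDecay u₀` deleted (nothing else forces `u₀ ∈ L²`), the
statement is false for the wrong reason (`classBudgetsRegularise_false_without_decay`): at the
constant datum `u₀ ≡ e₀`, `ν = 1`, no Leray–Hopf object exists, the budget hypothesis holds
vacuously, and the conclusion's `HasBoundedEnergy` fails at `t = 0` (`∫ ‖e₀‖² = ∞`).

Information for provers: any proof of the crux must use the decay (at least the square
integrability) of the datum — concretely through local existence of a classical Leray–Hopf solution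
from `u₀` (`navierStokesRegularity_of_noBlowup`, Theorems/NoBlowupToClay.lean, step 1), to which the
budget hypothesis is then applied at the Kato maximal time.
-/

noncomputable section

namespace Summit.NavierStokesRegularity.NavierStokesRegularity.Theorems.ClassBudgetsRegularise.Negative

open MeasureTheory Set Filter
open scoped ENNReal RealInnerProductSpace
open Literature.Analysis.FluidPDE

/-- A nonzero constant vector field on `ℝ³` is not square integrable (Lebesgue measure of `ℝ³` is
infinite, Mathlib `measure_univ_of_isAddLeftInvariant`, `memLp_const_iff`). [folklore] -/
theorem not_memLp_two_const {e : EuclideanSpace ℝ (Fin 3)} (he : e ≠ 0) :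
    ¬ MemLp (fun _ : EuclideanSpace ℝ (Fin 3) => e) 2 (volume : Measure (EuclideanSpace ℝ (Fin 3))) := by
  rw [memLp_const_iff two_ne_zero ENNReal.ofNat_ne_top]
  rintro (h1 | h2)
  · exact he h1
  · rw [measure_univ_of_isAddLeftInvariant] at h2
    exact lt_irrefl _ h2

/-- **`ClassBudgetsRegularise` with `HasRapidSpatialDecay u₀` deleted is false.** Witness `ν = 1`,
`u₀ ≡ EuclideanSpace.single 0 1`: smooth and divergence free; no `u` with `u 0 = u₀` is Leray–Hopf
(`memLp` at `t = 0` would put the constant in `L²(ℝ³)`), so the budget hypothesis is vacuous; and no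
field with `u 0 = u₀` has bounded energy (`∫⁻ ‖u₀‖ₑ² = ‖e₀‖ₑ² · |ℝ³| = ∞`). [folklore] -/
theorem classBudgetsRegularise_false_without_decay :
    ¬ (∀ ν : ℝ, 0 < ν → ∀ u₀ : EuclideanSpace ℝ (Fin 3) → EuclideanSpace ℝ (Fin 3),
        ContDiff ℝ (⊤ : ℕ∞) u₀ → Literature.Analysis.FluidPDE.NSWave0.IsDivFree u₀ →
        (∀ T : ℝ, 0 < T → ∀ (u : ℝ → EuclideanSpace ℝ (Fin 3) → EuclideanSpace ℝ (Fin 3))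
            (p : ℝ → EuclideanSpace ℝ (Fin 3) → ℝ),
          Literature.Analysis.FluidPDE.IsClassicalNSSolutionOn (Set.Ico 0 T) ν 0 u p →
          Literature.Analysis.FluidPDE.IsLerayHopfOn T ν 0 (u 0) u → u 0 = u₀ →
          ∃ l : ℝ, 0 < l ∧
            (∃ C : ℝ, ∀ t ∈ Set.Ico 0 T,
              MeasureTheory.IntegrableOn (fun z : ℝ × EuclideanSpace ℝ (Fin 3) =>
                inner ℝ (Literature.Analysis.FluidPDE.curl (u z.1) z.2)
                  (fderiv ℝ (u z.1) z.2 (Literature.Analysis.FluidPDE.curl (u z.1) z.2)))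
                {z : ℝ × EuclideanSpace ℝ (Fin 3) | z.1 ∈ Set.Ioo 0 t ∧ ‖u z.1 z.2‖ ≤ l} ∧
              ∫ z in {z : ℝ × EuclideanSpace ℝ (Fin 3) | z.1 ∈ Set.Ioo 0 t ∧ ‖u z.1 z.2‖ ≤ l},
                inner ℝ (Literature.Analysis.FluidPDE.curl (u z.1) z.2)
                  (fderiv ℝ (u z.1) z.2 (Literature.Analysis.FluidPDE.curl (u z.1) z.2)) ≤ C) ∧
            (∃ q : ℝ, 3 / 2 < q ∧ ∃ m : ℝ → EuclideanSpace ℝ (Fin 3) → ℝ, (∀ t x, 0 ≤ m t x) ∧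
              (∀ t ∈ Set.Ico 0 T, ∀ x, l < ‖u t x‖ → ∃ v w : EuclideanSpace ℝ (Fin 3),
                ‖v‖ = 1 ∧ ‖w‖ = 1 ∧ inner ℝ v w = 0 ∧ ∀ α β : ℝ,
                  inner ℝ (fderiv ℝ (u t) x (α • v + β • w)) (α • v + β • w) ≤ m t x * (α ^ 2 + β ^ 2)) ∧
              ∫⁻ t in Set.Ioo 0 T, (∫⁻ x in {x : EuclideanSpace ℝ (Fin 3) | l < ‖u t x‖},
                ENNReal.ofReal (m t x) ^ q) ^ (2 / (2 * q - 3)) < ⊤)) →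
        ∃ (u : ℝ → EuclideanSpace ℝ (Fin 3) → EuclideanSpace ℝ (Fin 3))
          (p : ℝ → EuclideanSpace ℝ (Fin 3) → ℝ),
          Literature.Analysis.FluidPDE.IsSmoothOnHalfSpace u ∧
          Literature.Analysis.FluidPDE.IsSmoothOnHalfSpace p ∧
          Literature.Analysis.FluidPDE.IsNavierStokesSolution ν 0 u₀ u p ∧
          Literature.Analysis.FluidPDE.HasBoundedEnergy u) := by
  intro h
  set e : EuclideanSpace ℝ (Fin 3) := EuclideanSpace.single 0 1 with he
  have hne : ‖e‖ = 1 := by simp [he]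
  have he0 : e ≠ 0 := by
    intro h0
    rw [h0, norm_zero] at hne
    exact zero_ne_one hne
  have hdiv : Literature.Analysis.FluidPDE.NSWave0.IsDivFree
      (fun _ : EuclideanSpace ℝ (Fin 3) => e) := by
    intro x
    simp [Literature.Analysis.FluidPDE.NSWave0.divergence]
  -- the budget hypothesis is vacuous at the constant datum: no Leray–Hopf object has `u 0 = e`
  obtain ⟨u, p, -, -, hNS, hE⟩ := h 1 one_pos (fun _ => e) contDiff_const hdiv (by
    intro T hT u p _ hLH hu0
    exfalso
    have h2 := hLH.memLp 0 ⟨le_rfl, hT.le⟩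
    rw [hu0] at h2
    exact not_memLp_two_const he0 h2)
  -- … while the conclusion fails at `t = 0`
  obtain ⟨C, hC, hCt⟩ := hE
  have h0 := hCt 0 le_rfl
  rw [hNS.initial] at h0
  have htop : ∫⁻ x : EuclideanSpace ℝ (Fin 3),
      ‖(fun _ : EuclideanSpace ℝ (Fin 3) => e) x‖ₑ ^ 2 = ⊤ := by
    rw [lintegral_const, measure_univ_of_isAddLeftInvariant, ENNReal.mul_top]
    exact pow_ne_zero _ (enorm_ne_zero.2 he0)
  rw [htop] at h0
  exact absurd (lt_of_le_of_lt h0 hC) (lt_irrefl _)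

end Summit.NavierStokesRegularity.NavierStokesRegularity.Theorems.ClassBudgetsRegularise.Negative

end
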